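import Literature.NumberTheory.LFunctions.ClassGroupSmoothedCosets
import Literature.NumberTheory.Sieve.SquarefreeSieve
import Literature.NumberTheory.LFunctions.DedekindZetaVonMangoldt
import Literature.NumberTheory.LFunctions.DedekindZetaERHProofs
import HarnessLib

/-!
# Sifted smoothed sums over an ideal class (Thorner–Zaman 2017, Lemma 4.6, for the class group)

Topic `Literature/NumberTheory/LFunctions`, namespace `Literature.NumberTheory.LFunctions.NumberField`.
Everything here is PROVED (definitions with bodies + theorems; no named facts).

We sift the ideals of a class `C ∈ Cl_K` by the prime ideals of norm `≤ z` with the abstract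
squarefree `Λ²`-sieve of `Sieve/SquarefreeSieve.lean`, the local data being supplied by
`ClassGroupSmoothedCosets.norm_tsum_dvd_class_sub_le` (TZ Cor. 4.5).  With Weiss's kernel
`φ = φ_{m+1}` (parameter `A`), `u = log x`, `P_z` = primes of norm `≤ z`, squarefree divisors
`𝔡_S = ∏_{v∈S} v` (`S ⊆ P_z`), admissible `D_z = {S ⊆ P_z : N𝔡_S ≤ z}`,
`V'(z) = Σ_{S ∈ D_z} 1/N𝔡_S`, and `κ₀ = Re(Z₁(1)/h)` (`= κ_K/h ≥ 0`):

* `primesLE`, `sqfIdeal`, `sqfIdeal_dvd_iff` (`𝔡_S ∣ 𝔫 ↔ ∀ v ∈ S, v ∣ 𝔫`), `absNorm_sqfIdeal`,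
  `admissible` (closed under subsets, contains `∅` for `z ≥ 1`);
* `re_classTwistedZeta₁_one_nonneg` — `κ₀ ≥ 0` (`Z₁(σ) = (σ−1)ζ_K(σ) > 0` for `σ > 1`);
* `sifted_classSum_le` — **TZ Lemma 4.6 for the class group**: for `z ≥ 1`, `m ≥ n_K + 3`,
  `Σ_{𝔫 ∈ C, (𝔫, P_z) = 1} N𝔫^{−1} φ(u − log N𝔫) ≤ κ₀ / V'(z) + |D_z|² · (1/3)|d_K|e^{2n_K} C e^{−3u/2} z`
  (`C = majorConst A m (n_K+1)`; the sum runs over the finitely many `𝔫` in the window of `φ`).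

## References

* [ThornerZaman2017] J. Thorner, A. Zaman, *An explicit bound for the least prime ideal in the
  Chebotarev density theorem*, Algebra Number Theory 11 (2017), Lemma 4.6.
* [Weiss1983] A. Weiss, *The least prime ideal*, J. reine angew. Math. 338 (1983), Lemma 3.6.
-/

noncomputable section

open MeasureTheory Real Complex Set Filter Finset IsDedekindDomain
open scoped Topology

namespace Literature.NumberTheory.LFunctions.NumberField

open Literature.NumberTheory.LFunctions.WeissKernel Literature.NumberTheory.Sieve.Squarefree
open scoped nonZeroDivisors _root_.NumberField Classical

variable {K : Type*} [Field K] [NumberField K]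

/-! ### Primes of small norm and squarefree divisors -/

variable (K) in
/-- The primes `v` of `K` with `N v ≤ z`. [folklore] -/
def primesLE (z : ℝ) : Finset (HeightOneSpectrum (𝓞 K)) :=
  (Set.Finite.preimage (f := fun v : HeightOneSpectrum (𝓞 K) ↦ v.asIdeal)
    (fun _ _ _ _ h ↦ HeightOneSpectrum.ext h) (Ideal.finite_setOf_absNorm_le (S := 𝓞 K) ⌊z⌋₊)).toFinset

/-- Membership in `primesLE`. [folklore] -/
theorem mem_primesLE {z : ℝ} (hz : 0 ≤ z) {v : HeightOneSpectrum (𝓞 K)} :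
    v ∈ primesLE K z ↔ (Ideal.absNorm v.asIdeal : ℝ) ≤ z := by
  rw [primesLE, Set.Finite.mem_toFinset, Set.mem_preimage, Set.mem_setOf_eq, Nat.le_floor_iff hz]

/-- The squarefree ideal `𝔡_S = ∏_{v ∈ S} v`. [folklore] -/
def sqfIdeal (S : Finset (HeightOneSpectrum (𝓞 K))) : Ideal (𝓞 K) := ∏ v ∈ S, v.asIdeal

omit [NumberField K] in
/-- `𝔡_S ≠ 0`. [folklore] -/
theorem sqfIdeal_ne_bot (S : Finset (HeightOneSpectrum (𝓞 K))) : sqfIdeal S ≠ ⊥ := by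
  rw [sqfIdeal, Ne, ← Ideal.zero_eq_bot, Finset.prod_eq_zero_iff]
  push Not
  intro v _
  rw [Ideal.zero_eq_bot]
  exact v.ne_bot

/-- **`𝔡_S ∣ 𝔫 ↔ v ∣ 𝔫` for all `v ∈ S`** (the `v ∈ S` are distinct primes, so `∏ v = ⊓ v`).
[folklore] -/
theorem sqfIdeal_dvd_iff (S : Finset (HeightOneSpectrum (𝓞 K))) (I : Ideal (𝓞 K)) :
    sqfIdeal S ∣ I ↔ ∀ v ∈ S, v.asIdeal ∣ I := by
  have h := IsDedekindDomain.inf_pow_eq_prod_of_prime S (fun v : HeightOneSpectrum (𝓞 K) ↦ v.asIdeal)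
    (fun _ ↦ 1) (fun v _ ↦ v.prime) (fun v _ w _ hvw h ↦ hvw (HeightOneSpectrum.ext h))
  simp only [pow_one] at h
  rw [sqfIdeal, ← h, Ideal.dvd_iff_le, Finset.le_inf_iff]
  exact forall₂_congr fun v _ ↦ Ideal.dvd_iff_le.symm

/-- `N𝔡_S = ∏_{v∈S} N v` (as a real number: `nrm`). [folklore] -/
theorem absNorm_sqfIdeal (S : Finset (HeightOneSpectrum (𝓞 K))) :
    ((Ideal.absNorm (sqfIdeal S) : ℕ) : ℝ) = nrm (fun v : HeightOneSpectrum (𝓞 K) ↦ (Ideal.absNorm v.asIdeal : ℝ)) S := by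
  rw [sqfIdeal, map_prod, Nat.cast_prod, nrm]

/-- Norms of primes exceed `1`. [folklore] -/
theorem one_lt_absNorm_real (v : HeightOneSpectrum (𝓞 K)) : (1 : ℝ) < (Ideal.absNorm v.asIdeal : ℝ) := by
  have := Literature.NumberTheory.LFunctions.AbelianDensity.two_le_absNorm K v
  exact_mod_cast (by omega : 1 < Ideal.absNorm v.asIdeal)

variable (K) in
/-- The admissible squarefree divisors: `D_z = {S ⊆ P_z : N𝔡_S ≤ z}`. [folklore] -/
def admissible (z : ℝ) : Finset (Finset (HeightOneSpectrum (𝓞 K))) :=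
  (primesLE K z).powerset.filter fun S ↦
    nrm (fun v : HeightOneSpectrum (𝓞 K) ↦ (Ideal.absNorm v.asIdeal : ℝ)) S ≤ z

/-- Membership in `admissible`. [folklore] -/
theorem mem_admissible {z : ℝ} {S : Finset (HeightOneSpectrum (𝓞 K))} :
    S ∈ admissible K z ↔ S ⊆ primesLE K z ∧
      nrm (fun v : HeightOneSpectrum (𝓞 K) ↦ (Ideal.absNorm v.asIdeal : ℝ)) S ≤ z := by
  rw [admissible, mem_filter, Finset.mem_powerset]

/-- `nrm` is monotone in the set (all factors `≥ 1`). [folklore] -/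
theorem nrm_mono {S T : Finset (HeightOneSpectrum (𝓞 K))} (h : T ⊆ S) :
    nrm (fun v : HeightOneSpectrum (𝓞 K) ↦ (Ideal.absNorm v.asIdeal : ℝ)) T ≤
      nrm (fun v : HeightOneSpectrum (𝓞 K) ↦ (Ideal.absNorm v.asIdeal : ℝ)) S := by
  have hN : ∀ v : HeightOneSpectrum (𝓞 K), 1 < (Ideal.absNorm v.asIdeal : ℝ) := one_lt_absNorm_real
  rw [nrm_eq_mul_sdiff (N := fun v : HeightOneSpectrum (𝓞 K) ↦ (Ideal.absNorm v.asIdeal : ℝ)) h]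
  have h1 := one_le_nrm hN (S \ T)
  have h2 := nrm_pos hN T
  nlinarith

/-- `D_z` is closed under subsets. [folklore] -/
theorem admissible_down {z : ℝ} {S : Finset (HeightOneSpectrum (𝓞 K))} (hS : S ∈ admissible K z)
    {T : Finset (HeightOneSpectrum (𝓞 K))} (hT : T ⊆ S) : T ∈ admissible K z := by
  rw [mem_admissible] at hS ⊢
  exact ⟨hT.trans hS.1, (nrm_mono hT).trans hS.2⟩

/-- `∅ ∈ D_z` for `z ≥ 1`. [folklore] -/
theorem empty_mem_admissible {z : ℝ} (hz : 1 ≤ z) : (∅ : Finset (HeightOneSpectrum (𝓞 K))) ∈ admissible K z := by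
  rw [mem_admissible, nrm_empty]
  exact ⟨empty_subset _, hz⟩

/-- `N𝔡_{S₁ ∪ S₂} ≤ z²` for `S₁, S₂ ∈ D_z`. [folklore] -/
theorem nrm_union_le_sq {z : ℝ} (hz : 1 ≤ z) {S₁ S₂ : Finset (HeightOneSpectrum (𝓞 K))}
    (h₁ : S₁ ∈ admissible K z) (h₂ : S₂ ∈ admissible K z) :
    nrm (fun v : HeightOneSpectrum (𝓞 K) ↦ (Ideal.absNorm v.asIdeal : ℝ)) (S₁ ∪ S₂) ≤ z ^ 2 := by
  have hN : ∀ v : HeightOneSpectrum (𝓞 K), 1 < (Ideal.absNorm v.asIdeal : ℝ) := one_lt_absNorm_real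
  have h := nrm_union_mul_nrm_inter (N := fun v : HeightOneSpectrum (𝓞 K) ↦ (Ideal.absNorm v.asIdeal : ℝ)) S₁ S₂
  have hi := one_le_nrm hN (S₁ ∩ S₂)
  have hu := (nrm_pos hN (S₁ ∪ S₂)).le
  have h1 := (mem_admissible.mp h₁).2
  have h2 := (mem_admissible.mp h₂).2
  have h1' := (nrm_pos hN S₁).le
  nlinarith

/-! ### The main-term constant `κ₀ = Re(Z₁(1)/h) ≥ 0` -/

/-- **`Re Z₁(1) ≥ 0`** for the trivial twist: `Z₁(σ) = (σ − 1)ζ_K(σ) > 0` for real `σ > 1`, and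
`Z₁` is continuous at `1`. [folklore] -/
theorem re_classTwistedZeta₁_one_nonneg : 0 ≤ (classTwistedZeta₁ K (fun _ ↦ (1 : ℂ)) 1).re := by
  have hcont : Continuous fun σ : ℝ ↦ (classTwistedZeta₁ K (fun _ ↦ (1 : ℂ)) σ).re :=
    Complex.continuous_re.comp ((differentiable_classTwistedZeta₁ (K := K) _).continuous.comp
      Complex.continuous_ofReal)
  have hlim : Tendsto (fun σ : ℝ ↦ (classTwistedZeta₁ K (fun _ ↦ (1 : ℂ)) σ).re) (𝓝[>] 1)
      (𝓝 (classTwistedZeta₁ K (fun _ ↦ (1 : ℂ)) 1).re) := by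
    have := hcont.tendsto 1
    simp only [Complex.ofReal_one] at this
    exact this.mono_left nhdsWithin_le_nhds
  refine ge_of_tendsto hlim ?_
  filter_upwards [self_mem_nhdsWithin] with σ hσ
  rw [Set.mem_Ioi] at hσ
  have hσ1 : (σ : ℂ) ≠ 1 := by
    intro h; have := congrArg Complex.re h; simp at this; linarith
  rw [classTwistedZeta₁_apply_of_ne_one _ hσ1, classTwistedZeta_one hσ1,
    dedekindZetaCont_eq_dedekindZeta_holds (K := K) (by simpa using hσ)]
  have hζ := dedekindZeta_pos (K := K) hσ
  rw [Complex.mul_re]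
  have him : (NumberField.dedekindZeta K σ).im = 0 := (Complex.pos_iff.mp hζ).2.symm
  have hre : 0 < (NumberField.dedekindZeta K σ).re := (Complex.pos_iff.mp hζ).1
  simp only [Complex.sub_re, Complex.ofReal_re, Complex.one_re, Complex.sub_im, Complex.ofReal_im,
    Complex.one_im, sub_zero]
  rw [him, mul_zero, sub_zero]
  nlinarith

/-! ### The sifted class sum (TZ Lemma 4.6) -/

/-- The complex sums of `ClassGroupSmoothedCosets` are the finite real sums over the window
`N𝔫 ≤ e^{u + (m+1)/A}`. [folklore] -/
theorem tsum_dvd_class_eq_sum (𝔡 : Ideal (𝓞 K)) (C : ClassGroup (𝓞 K)) {A : ℝ} (hA : 0 < A)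
    (m : ℕ) (u : ℝ) :
    ∑' I : Ideal (𝓞 K), (if 𝔡 ∣ I ∧ I ≠ ⊥ ∧ idealClass I = C then (1 : ℂ) else 0) *
        ((Ideal.absNorm I : ℕ) : ℂ)⁻¹ * (phi A m (u - Real.log (Ideal.absNorm I)) : ℂ) =
      ((∑ I ∈ (Ideal.finite_setOf_absNorm_le (S := 𝓞 K) ⌊Real.exp (u + ((m : ℝ) + 1) / A)⌋₊).toFinset
          with 𝔡 ∣ I,
        (if I ≠ ⊥ ∧ idealClass I = C then (1 : ℝ) else 0) * ((Ideal.absNorm I : ℕ) : ℝ)⁻¹ *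
          phi A m (u - Real.log (Ideal.absNorm I)) : ℝ) : ℂ) := by
  rw [tsum_eq_sum (s := (Ideal.finite_setOf_absNorm_le (S := 𝓞 K) ⌊Real.exp (u + ((m : ℝ) + 1) / A)⌋₊).toFinset)]
  · rw [Finset.sum_filter]
    push_cast
    refine Finset.sum_congr rfl fun I _ ↦ ?_
    by_cases hd : 𝔡 ∣ I
    · rw [if_pos hd]
      by_cases hI : I ≠ ⊥ ∧ idealClass I = C
      · rw [if_pos ⟨hd, hI⟩, if_pos hI]; push_cast; ring
      · rw [if_neg (fun h ↦ hI h.2), if_neg hI]; push_cast; ring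
    · rw [if_neg hd, if_neg (fun h ↦ hd h.1), zero_mul, zero_mul]; push_cast; ring
  · intro I hI
    rw [Set.Finite.mem_toFinset, Set.mem_setOf_eq, not_le] at hI
    have : Real.exp (u + ((m : ℝ) + 1) / A) < Ideal.absNorm I := (Nat.floor_lt (Real.exp_pos _).le).mp hI
    rw [phi_sub_log_eq_zero hA m u this]
    simp

/-- **Thorner–Zaman Lemma 4.6 for the class group** (sifted smoothed class sum): for a class `C`,
`z ≥ 1`, `m ≥ n_K + 3`, `A > 0` and every real `u`,
`Σ_{𝔫 ∈ C, v ∤ 𝔫 (N v ≤ z)} N𝔫^{−1} φ(u − log N𝔫) ≤ κ₀/V'(z) + |D_z|² · (1/3)|d_K|e^{2n_K} C e^{−3u/2} z`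
with `κ₀ = Re(Z₁(1)/h) (= κ_K/h)`, `V'(z) = Σ_{S∈D_z} 1/N𝔡_S`, `C = majorConst A m (n_K+1)`; the sum
runs over the (finitely many) `𝔫` with `N𝔫 ≤ e^{u+(m+1)/A}` (outside, `φ = 0`).  Proof: the abstract
squarefree sieve `Sieve.Squarefree.sifted_sum_le` fed with `norm_tsum_dvd_class_sub_le`
(TZ Cor. 4.5) at the squarefree `𝔡_{S₁∪S₂}`, `N𝔡 ≤ z²`. [cite: ThornerZaman2017, Lemma 4.6] -/
theorem sifted_classSum_le (C : ClassGroup (𝓞 K)) {A : ℝ} (hA : 0 < A) {m : ℕ}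
    (hm : Module.finrank ℚ K + 3 ≤ m) (u : ℝ) {z : ℝ} (hz : 1 ≤ z) :
    ∑ I ∈ (Ideal.finite_setOf_absNorm_le (S := 𝓞 K) ⌊Real.exp (u + ((m : ℝ) + 1) / A)⌋₊).toFinset
        with (∀ v : HeightOneSpectrum (𝓞 K), (Ideal.absNorm v.asIdeal : ℝ) ≤ z → ¬ v.asIdeal ∣ I),
      (if I ≠ ⊥ ∧ idealClass I = C then (1 : ℝ) else 0) * ((Ideal.absNorm I : ℕ) : ℝ)⁻¹ *
        phi A m (u - Real.log (Ideal.absNorm I)) ≤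
      (classTwistedZeta₁ K (fun _ ↦ (1 : ℂ)) 1 / Fintype.card (ClassGroup (𝓞 K))).re /
          bigV (fun v : HeightOneSpectrum (𝓞 K) ↦ (Ideal.absNorm v.asIdeal : ℝ)) (admissible K z) +
        ((admissible K z).card : ℝ) ^ 2 *
          (1 / 3 * (((NumberField.discr K).natAbs : ℝ) * Real.exp (2 * Module.finrank ℚ K)) *
            majorConst A m (Module.finrank ℚ K + 1) * Real.exp (-(3 / 2 * u)) * z) := by
  have hz0 : 0 ≤ z := by linarith
  set Nf : HeightOneSpectrum (𝓞 K) → ℝ := fun v ↦ (Ideal.absNorm v.asIdeal : ℝ) with hNf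
  have hN : ∀ v, 1 < Nf v := one_lt_absNorm_real
  set Aset := (Ideal.finite_setOf_absNorm_le (S := 𝓞 K) ⌊Real.exp (u + ((m : ℝ) + 1) / A)⌋₊).toFinset
    with hAset
  set w : Ideal (𝓞 K) → ℝ := fun I ↦ (if I ≠ ⊥ ∧ idealClass I = C then (1 : ℝ) else 0) *
    ((Ideal.absNorm I : ℕ) : ℝ)⁻¹ * phi A m (u - Real.log (Ideal.absNorm I)) with hw
  have hw0 : ∀ I, 0 ≤ w I := by
    intro I; rw [hw]; dsimp only
    refine mul_nonneg (mul_nonneg ?_ (by positivity)) (phi_nonneg hA m _)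
    split_ifs <;> norm_num
  set dv : Ideal (𝓞 K) → Finset (HeightOneSpectrum (𝓞 K)) := fun I ↦ (primesLE K z).filter (·.asIdeal ∣ I)
    with hdv
  set κc : ℂ := classTwistedZeta₁ K (fun _ ↦ (1 : ℂ)) 1 / Fintype.card (ClassGroup (𝓞 K)) with hκc
  set err : ℝ := 1 / 3 * (((NumberField.discr K).natAbs : ℝ) * Real.exp (2 * Module.finrank ℚ K)) *
    majorConst A m (Module.finrank ℚ K + 1) * Real.exp (-(3 / 2 * u)) with herr
  have herr0 : 0 ≤ err := by
    have := majorConst_pos A m (Module.finrank ℚ K + 1); positivity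
  have hX : 0 ≤ κc.re := by
    rw [hκc, Complex.div_natCast_re]
    exact div_nonneg re_classTwistedZeta₁_one_nonneg (Nat.cast_nonneg _)
  -- the local estimate from Cor 4.5
  have hR : ∀ S₁ ∈ admissible K z, ∀ S₂ ∈ admissible K z,
      |∑ n ∈ Aset.filter (fun n ↦ S₁ ∪ S₂ ⊆ dv n), w n - κc.re / nrm Nf (S₁ ∪ S₂)| ≤ err * z := by
    intro S₁ h₁ S₂ h₂
    set S := S₁ ∪ S₂ with hS
    have hSP : S ⊆ primesLE K z := union_subset (mem_admissible.mp h₁).1 (mem_admissible.mp h₂).1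
    -- the filter condition is `𝔡_S ∣ n`
    have hfil : Aset.filter (fun n ↦ S ⊆ dv n) = Aset.filter (fun n ↦ sqfIdeal S ∣ n) := by
      refine Finset.filter_congr fun I _ ↦ ?_
      rw [sqfIdeal_dvd_iff]
      constructor
      · intro h v hv
        exact (mem_filter.mp (h hv)).2
      · intro h v hv
        exact mem_filter.mpr ⟨hSP hv, h v hv⟩
    have hsum : ((∑ n ∈ Aset.filter (fun n ↦ S ⊆ dv n), w n : ℝ) : ℂ) =
        ∑' I : Ideal (𝓞 K), (if sqfIdeal S ∣ I ∧ I ≠ ⊥ ∧ idealClass I = C then (1 : ℂ) else 0) *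
          ((Ideal.absNorm I : ℕ) : ℂ)⁻¹ * (phi A m (u - Real.log (Ideal.absNorm I)) : ℂ) := by
      rw [hfil, tsum_dvd_class_eq_sum (sqfIdeal S) C hA m u]
    have hcor := norm_tsum_dvd_class_sub_le (sqfIdeal_ne_bot S) C hA hm u
    rw [← hsum] at hcor
    have hnrm : nrm Nf S = ((Ideal.absNorm (sqfIdeal S) : ℕ) : ℝ) := (absNorm_sqfIdeal S).symm
    -- real part
    have hre : ∑ n ∈ Aset.filter (fun n ↦ S ⊆ dv n), w n - κc.re / nrm Nf S =
        ((((∑ n ∈ Aset.filter (fun n ↦ S ⊆ dv n), w n : ℝ) : ℂ)) -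
          classTwistedZeta₁ K (fun _ ↦ (1 : ℂ)) 1 / Fintype.card (ClassGroup (𝓞 K)) /
            (Ideal.absNorm (sqfIdeal S) : ℕ)).re := by
      rw [Complex.sub_re, Complex.ofReal_re, Complex.div_natCast_re, hnrm, Complex.div_natCast_re,
        Complex.div_natCast_re]
    rw [hre]
    refine (Complex.abs_re_le_norm _).trans (hcor.trans ?_)
    refine mul_le_mul_of_nonneg_left ?_ herr0
    rw [Real.sqrt_le_left hz0, ← hnrm]
    exact nrm_union_le_sq hz h₁ h₂
  have hmain := sifted_sum_le hN (fun S hS T hT ↦ admissible_down hS hT) (empty_mem_admissible hz)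
    Aset w hw0 dv hX hR
  -- the sifted condition
  have hfil : Aset.filter (fun n ↦ dv n = ∅) =
      Aset.filter (fun I ↦ ∀ v : HeightOneSpectrum (𝓞 K), (Ideal.absNorm v.asIdeal : ℝ) ≤ z → ¬ v.asIdeal ∣ I) := by
    refine Finset.filter_congr fun I _ ↦ ?_
    rw [hdv]; dsimp only
    rw [Finset.filter_eq_empty_iff]
    constructor
    · intro h v hv hd
      exact h ((mem_primesLE hz0).mpr hv) hd
    · intro h v hv hd
      exact h v ((mem_primesLE hz0).mp hv) hd
  rw [hfil] at hmain
  exact hmain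

end Literature.NumberTheory.LFunctions.NumberField

end
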